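import Literature.RepresentationTheory.CompactGroups.WeylIntegrationAdAction
import Literature.LinearAlgebra.Matrix.CharpolyDiscriminantNull
import Mathlib.MeasureTheory.Function.Jacobian

/-!
# Weyl's integral formula for `U(n)`, file 5: THE LIE-ALGEBRA CLASS-FUNCTION FORMULA
# `∫_{𝔲(n)} Φ = c · ∫_C Φ(i diag θ) Π_{j≺k}(θ_j − θ_k)² dθ` for `Ad`-invariant `Φ ≥ 0`

statement-level skeleton of published theorems with citation tags; proofs where landed; nothing here is a claim
about the Yang–Mills mass gap

Mega-formalization `lit-balaban` (HOME `run/shared/lean/pub/lit-balaban/`), unit `lit-balaban-p28` gen 15 (Phase-2 proof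
seat, free-target protocol G.5-34(d)): FILE 5 of the discharge of the tree's named fact
`Literature.RepresentationTheory.CompactGroups.weylIntegralFormula_unitary` ([BtD] IV (1.11), `G = U(n)`).  This is
Helgason's Theorem I.5.17 — «`∫_𝔭 f(X) dX = c ∫_{K/M} (∫_{𝔞⁺} f(Ad(k)H) δ(H) dH) dk_M`, `δ(H) = Π_{α∈Σ⁺} α(H)^{m_α}`» —
for the compact Lie algebra `𝔲(n)` (`𝔞⁺ = C` the Weyl chamber, `δ = Π_{j≺k}(θ_j − θ_k)²`, all `m_α = 2`), in the flat
coordinates of files 1–4 and for `Ad(U(n))`-INVARIANT integrands (the only case (1.11) needs), where the fibre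
integral `∫_{K/M} dk_M` collapses to a constant:
* §1 the chamber integral `J_C(Φ) = ∫_C Φ(0, θ) Π_{j≺k}(θ_j − θ_k)² dθ` and the transversal constant
  `a_r = ∫_{‖z‖<r} |det N(z)| dz ∈ (0, ∞)`;
* §2 CHANGE OF VARIABLES through the orbit map on `{‖z‖<r} × C` (Mathlib's
  `lintegral_image_eq_lintegral_abs_det_fderiv_mul`, the Jacobian factorisation of file 2, `|det Ad| = 1` and the
  injectivity of file 4): `∫_{orbitMap(B_r × C)} Φ = a_r · J_C(Φ)` (`lintegral_image_orbitMap`);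
* §3 AVERAGING over a right-invariant probability measure `μ` on `U(n)` (Tonelli): the mass
  `m(y) = μ{g : Ad(g) y ∈ orbitMap(B_r × C)}` is the constant `μ(E_r)` at every regular `y` (file 3's sorted
  diagonalisation; the `T`-coset set `E_r` does not depend on the eigenvalues), the non-regular `y` are Lebesgue-null
  (gen 14, Mityagin), whence `μ(E_r) · ∫ Φ = a_r · J_C(Φ)` (`measure_coreSet_mul_lintegral_eq`);
* §4 **`exists_const_lintegral_eq_chamberIntegral`**: `∃ c ∈ (0, ∞) ∀ Φ` measurable `Ad`-invariant,
  `∫ Φ d(vol) = c · J_C(Φ)`; and the `ℝⁿ` form `∫ Φ = c' ∫_{ℝⁿ} Φ(0, θ) Π_{j≺k}(θ_j − θ_k)² dθ` (file 3's `n!`).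

0 named facts, 0 sorry.  The constant `c` is not evaluated here (it is fixed in the assembly file by `Φ ≡ 1`).

## References
* S. Helgason, *Groups and Geometric Analysis*, AMS Surveys 83 (2000), Ch. I §5 Thm. 5.17, p. 195 (held:
  `book:helgason2000-groups-geometric-analysis`, p0186). [Helgason2000]
* Th. Bröcker, T. tom Dieck, *Representations of Compact Lie Groups*, GTM 98 (1985), Ch. IV (1.8), (1.11) pp. 161–163
  (held: `book:brockernd-representations-compact-lie-groups`, p0152–p0153). [BrockerTomDieck1985]
-/

noncomputable section

open Complex Matrix MeasureTheory Equiv NormedSpace Set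
open scoped ComplexConjugate Matrix.Norms.L2Operator ENNReal

namespace Literature.RepresentationTheory.CompactGroups.WeylIntegration

open Literature.MathematicalPhysics.QuantumFieldTheory.Balaban1983to89 (unitaryLogChart mem_unitaryLogChart_lie)
open Literature.MathematicalPhysics.QuantumFieldTheory.Balaban1983to89.UnitaryLogSpectralForm
  (exists_mem_unitaryLogChart_lie_separable)
open Literature.LinearAlgebra.Matrix (addHaar_setOf_not_separable_charpoly_eq_zero)

variable {n : Type*} [Fintype n] [DecidableEq n]

/-! ## §1 The chamber integral and the transversal constant -/

/-- THE CHAMBER INTEGRAL `J_C(Φ) = ∫_C Φ(0, θ) Π_{j≺k}(θ_j − θ_k)² dθ` (Helgason's `∫_{𝔞⁺} f(H) δ(H) dH`).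
[cite: Helgason2000, Ch. I §5 Thm. 5.17 p0186] -/
def chamberIntegral (Φ : Coord n → ℝ≥0∞) : ℝ≥0∞ :=
  ∫⁻ θ in chamber n, Φ ((0 : OD n → ℂ), θ) * ENNReal.ofReal (∏ p : OD n, (θ p.1.1 - θ p.1.2) ^ 2)

/-- THE TRANSVERSAL CONSTANT `a_r = ∫_{‖z‖<r} |det N(z)| dz`. [cite: Helgason2000, Ch. I §5 Thm. 5.17 p0186] -/
def sliceConst (n : Type*) [Fintype n] [DecidableEq n] (r : ℝ) : ℝ≥0∞ :=
  ∫⁻ z in Metric.ball (0 : OD n → ℂ) r, ENNReal.ofReal |(Nmap z).det|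

omit [DecidableEq n] in
/-- `θ ↦ Π_{j≺k}(θ_j − θ_k)²` is continuous. [cite: BrockerTomDieck1985, IV (1.11) p0153] -/
theorem continuous_prod_OD_sub_sq : Continuous fun θ : n → ℝ => ∏ p : OD n, (θ p.1.1 - θ p.1.2) ^ 2 :=
  continuous_finsetProd _ fun p _ => ((continuous_apply p.1.1).sub (continuous_apply p.1.2)).pow 2

omit [DecidableEq n] in
/-- The chamber integrand is measurable for measurable `Φ`. [cite: Helgason2000, Ch. I §5 Thm. 5.17 p0186] -/
theorem measurable_chamberIntegrand {Φ : Coord n → ℝ≥0∞} (hΦm : Measurable Φ) :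
    Measurable fun θ : n → ℝ => Φ ((0 : OD n → ℂ), θ) * ENNReal.ofReal (∏ p : OD n, (θ p.1.1 - θ p.1.2) ^ 2) :=
  (hΦm.comp (measurable_const.prodMk measurable_id)).mul
    (ENNReal.measurable_ofReal.comp continuous_prod_OD_sub_sq.measurable)

/-- `z ↦ |det N(z)|` (as `ℝ≥0∞`) is measurable. [cite: Helgason2000, Ch. I §5 Thm. 5.17 p0186] -/
theorem measurable_abs_det_Nmap : Measurable fun z : OD n → ℂ => ENNReal.ofReal |(Nmap z).det| :=
  ENNReal.measurable_ofReal.comp continuous_abs_det_Nmap.measurable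

omit [DecidableEq n] in
/-- `J_C(1) ≠ 0` (the chamber is a non-empty open set on which `Π(θ_j − θ_k)² > 0`).
[cite: Helgason2000, Ch. I §5 Thm. 5.17 p0186] -/
theorem chamberIntegral_one_ne_zero : chamberIntegral (n := n) (fun _ => 1) ≠ 0 := by
  intro h0
  simp only [chamberIntegral, one_mul] at h0
  have hmeas : Measurable fun θ : n → ℝ => ENNReal.ofReal (∏ p : OD n, (θ p.1.1 - θ p.1.2) ^ 2) :=
    ENNReal.measurable_ofReal.comp continuous_prod_OD_sub_sq.measurable
  have hae := (lintegral_eq_zero_iff hmeas).1 h0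
  rw [Filter.EventuallyEq, ae_restrict_iff' measurableSet_chamber] at hae
  have hnull : volume (chamber n) = 0 := by
    refine measure_mono_null (fun θ hθ => ?_) (ae_iff.1 hae)
    simp only [Set.mem_setOf_eq, Pi.zero_apply, ENNReal.ofReal_eq_zero, not_le, Classical.not_imp]
    exact ⟨hθ, prod_sub_sq_pos_of_mem_chamber hθ⟩
  exact (isOpen_chamber.measure_pos volume ⟨thetaStd n, thetaStd_mem_chamber⟩).ne' hnull

/-- `a_r ≠ 0` for `r > 0` (`|det N| > 1/2` near `z = 0`). [cite: Helgason2000, Ch. I §5 Thm. 5.17 p0186] -/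
theorem sliceConst_ne_zero {r : ℝ} (hr : 0 < r) : sliceConst n r ≠ 0 := by
  intro h0
  have hae := (lintegral_eq_zero_iff (measurable_abs_det_Nmap (n := n))).1 h0
  rw [Filter.EventuallyEq, ae_restrict_iff' measurableSet_ball] at hae
  set U : Set (OD n → ℂ) := {z | 1 / 2 < |(Nmap z).det|} ∩ Metric.ball 0 r with hU
  have hUo : IsOpen U := (isOpen_lt continuous_const continuous_abs_det_Nmap).inter Metric.isOpen_ball
  have h0U : (0 : OD n → ℂ) ∈ U := by
    refine ⟨?_, Metric.mem_ball_self hr⟩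
    simp only [Set.mem_setOf_eq, abs_det_Nmap_zero]; norm_num
  have hnull : volume U = 0 := by
    refine measure_mono_null (fun z hz => ?_) (ae_iff.1 hae)
    simp only [Set.mem_setOf_eq, Pi.zero_apply, ENNReal.ofReal_eq_zero, not_le, Classical.not_imp]
    exact ⟨hz.2, lt_trans (by norm_num) hz.1⟩
  exact (hUo.measure_pos volume ⟨0, h0U⟩).ne' hnull

/-- `a_r < ∞` (`|det N|` is bounded on the compact closed ball). [cite: Helgason2000, Ch. I §5 Thm. 5.17 p0186] -/
theorem sliceConst_ne_top (r : ℝ) : sliceConst n r ≠ ⊤ := by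
  obtain ⟨C, hC⟩ := (isCompact_closedBall (0 : OD n → ℂ) r).exists_bound_of_continuousOn
    (continuous_abs_det_Nmap (n := n)).continuousOn
  refine ne_of_lt (lt_of_le_of_lt (setLIntegral_mono' (μ := volume) measurableSet_ball (g := fun _ => ENNReal.ofReal C)
    fun z hz => ?_) ?_)
  · have := hC z (Metric.ball_subset_closedBall hz)
    rw [Real.norm_eq_abs, abs_abs] at this
    exact ENNReal.ofReal_le_ofReal this
  · rw [setLIntegral_const]
    exact ENNReal.mul_lt_top ENNReal.ofReal_lt_top measure_ball_lt_top

/-! ## §2 Change of variables through the orbit map on `{‖z‖ < r} × C` -/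

omit [DecidableEq n] in
/-- The slab `{‖z‖<r} × C` is measurable. [cite: Helgason2000, Ch. I §5 Thm. 5.17 p0186] -/
theorem measurableSet_slab (r : ℝ) : MeasurableSet (Metric.ball (0 : OD n → ℂ) r ×ˢ chamber n) :=
  measurableSet_ball.prod measurableSet_chamber

/-- The image `orbitMap(B_r × C)` is measurable (injective `C¹` image). [cite: Helgason2000, Ch. I §5 Thm. 5.17 p0186] -/
theorem measurableSet_image_orbitMap {r : ℝ} (hinj : InjOn (orbitMap (n := n)) (Metric.ball 0 r ×ˢ chamber n)) :
    MeasurableSet (orbitMap '' (Metric.ball (0 : OD n → ℂ) r ×ˢ chamber n)) :=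
  measurable_image_of_fderivWithin (measurableSet_slab r)
    (fun x _ => (hasFDerivAt_orbitMap x).hasFDerivWithinAt) hinj

/-- **CHANGE OF VARIABLES THROUGH THE ORBIT MAP**: for measurable `Ad(U(n))`-invariant `Φ ≥ 0`,
`∫_{orbitMap(B_r × C)} Φ = a_r · J_C(Φ)` (`|det D orbitMap(z, θ)| = |det N(z)| · Π_{j≺k}(θ_j − θ_k)²`,
`Φ(orbitMap(z, θ)) = Φ(0, θ)`). [cite: Helgason2000, Ch. I §5 Thm. 5.17 p0186] -/
theorem lintegral_image_orbitMap {r : ℝ} (hinj : InjOn (orbitMap (n := n)) (Metric.ball 0 r ×ˢ chamber n))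
    {Φ : Coord n → ℝ≥0∞} (hΦm : Measurable Φ) (hΦ : ∀ u ∈ Matrix.unitaryGroup n ℂ, ∀ x, Φ (AdCoord u x) = Φ x) :
    ∫⁻ y in orbitMap '' (Metric.ball (0 : OD n → ℂ) r ×ˢ chamber n), Φ y = sliceConst n r * chamberIntegral Φ := by
  rw [lintegral_image_eq_lintegral_abs_det_fderiv_mul volume (measurableSet_slab r)
    (fun x _ => (hasFDerivAt_orbitMap x).hasFDerivWithinAt) hinj]
  have hpt : ∀ x : Coord n, ENNReal.ofReal |(orbitDeriv x).det| * Φ (orbitMap x) =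
      ENNReal.ofReal |(Nmap x.1).det| *
        (Φ ((0 : OD n → ℂ), x.2) * ENNReal.ofReal (∏ p : OD n, (x.2 p.1.1 - x.2 p.1.2) ^ 2)) := by
    intro x
    have hnn : (0 : ℝ) ≤ ∏ p : OD n, (x.2 p.1.1 - x.2 p.1.2) ^ 2 := Finset.prod_nonneg fun p _ => sq_nonneg _
    rw [det_orbitDeriv, abs_mul, abs_mul, abs_det_AdCoord (exp_offMat_mem_unitaryGroup _), one_mul,
      abs_of_nonneg hnn, ENNReal.ofReal_mul (abs_nonneg _), orbitMap_eq_AdCoord, hΦ _ (exp_offMat_mem_unitaryGroup _)]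
    ring
  calc ∫⁻ x in Metric.ball (0 : OD n → ℂ) r ×ˢ chamber n, ENNReal.ofReal |(orbitDeriv x).det| * Φ (orbitMap x)
      = ∫⁻ x, (fun z : OD n → ℂ => ENNReal.ofReal |(Nmap z).det|) x.1 *
          (fun θ : n → ℝ => Φ ((0 : OD n → ℂ), θ) * ENNReal.ofReal (∏ p : OD n, (θ p.1.1 - θ p.1.2) ^ 2)) x.2
          ∂((volume.restrict (Metric.ball (0 : OD n → ℂ) r)).prod (volume.restrict (chamber n))) := by
        rw [Measure.prod_restrict]
        exact lintegral_congr fun x => hpt x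
    _ = sliceConst n r * chamberIntegral Φ :=
        lintegral_prod_mul measurable_abs_det_Nmap.aemeasurable (measurable_chamberIntegrand hΦm).aemeasurable

/-! ## §3 Averaging over `U(n)` -/

/-- THE `T`-COSET SET `E_r = {h ∈ U(n) : ∃ ‖z‖ < r, e^{−X(z)} h is diagonal} = exp(X(B_r)) · T`.
[cite: Helgason2000, Ch. I §5 Thm. 5.17 p0186] -/
def coreSet (n : Type*) [Fintype n] [DecidableEq n] (r : ℝ) : Set (Matrix.unitaryGroup n ℂ) :=
  {h | ∃ z ∈ Metric.ball (0 : OD n → ℂ) r, ∀ j k, j ≠ k → (star (exp (offMat z)) * (h : Matrix n n ℂ)) j k = 0}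

/-- **The set of `h` moving the slice point `(0, θ)`, `θ ∈ C`, into `orbitMap(B_r × C)` is `E_r` — independent of
`θ`** (file 3's `conj_diagI_eq_diagI`: the chamber component is unique and the conjugator lies in `e^{X(z)} T`).
[cite: Helgason2000, Ch. I §5 Thm. 5.17 p0186] -/
theorem preimage_AdCoord_slice_eq_coreSet {r : ℝ} {θ : n → ℝ} (hθ : θ ∈ chamber n) :
    (fun h : Matrix.unitaryGroup n ℂ => AdCoord (h : Matrix n n ℂ) (((0 : OD n → ℂ), θ) : Coord n)) ⁻¹'
      (orbitMap '' (Metric.ball (0 : OD n → ℂ) r ×ˢ chamber n)) = coreSet n r := by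
  ext h
  simp only [Set.mem_preimage, Set.mem_image, Set.mem_prod, coreSet, Set.mem_setOf_eq]
  constructor
  · rintro ⟨⟨z, θ'⟩, ⟨hz, hθ'⟩, hx⟩
    refine ⟨z, hz, ?_⟩
    set e := exp (offMat z) with he
    have heu : e ∈ Matrix.unitaryGroup n ℂ := exp_offMat_mem_unitaryGroup z
    have hM := congrArg toMat hx
    rw [toMat_orbitMap, toMat_AdCoord, toMat_zero_left] at hM
    have hV : star e * (h : Matrix n n ℂ) ∈ Matrix.unitaryGroup n ℂ := Submonoid.mul_mem _ (Unitary.star_mem heu) h.2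
    have hVD : star e * (h : Matrix n n ℂ) * diagI θ * star (star e * (h : Matrix n n ℂ)) = diagI θ' := by
      calc star e * (h : Matrix n n ℂ) * diagI θ * star (star e * (h : Matrix n n ℂ))
          = star e * ((h : Matrix n n ℂ) * diagI θ * star (h : Matrix n n ℂ)) * e := by
            rw [star_mul, star_star]; noncomm_ring
        _ = star e * (e * diagI θ' * star e) * e := by rw [← hM]
        _ = (star e * e) * diagI θ' * (star e * e) := by noncomm_ring
        _ = diagI θ' := by rw [Matrix.mem_unitaryGroup_iff'.1 heu, Matrix.one_mul, Matrix.mul_one]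
    exact (conj_diagI_eq_diagI hV hθ hθ' hVD).2
  · rintro ⟨z, hz, hoff⟩
    refine ⟨(z, θ), ⟨hz, hθ⟩, ?_⟩
    set e := exp (offMat z) with he
    have heu : e ∈ Matrix.unitaryGroup n ℂ := exp_offMat_mem_unitaryGroup z
    have ht := eq_diagonal_of_offDiag_eq_zero hoff
    set d : n → ℂ := fun j => (star e * (h : Matrix n n ℂ)) j j with hd
    have hdu : diagonal d ∈ Matrix.unitaryGroup n ℂ := by
      rw [← ht]; exact Submonoid.mul_mem _ (Unitary.star_mem heu) h.2
    have hh : (h : Matrix n n ℂ) = e * diagonal d := by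
      rw [← ht, ← Matrix.mul_assoc, Matrix.mem_unitaryGroup_iff.1 heu, Matrix.one_mul]
    apply toMat_injective
    rw [toMat_orbitMap, toMat_AdCoord, toMat_zero_left, hh, star_mul]
    calc e * diagI θ * star e = e * (diagonal d * diagI θ * star (diagonal d)) * star e := by
          rw [diagonal_conj_diagI hdu]
      _ = e * diagonal d * diagI θ * (star (diagonal d) * star e) := by noncomm_ring

section Averaging

variable (μ : Measure (Matrix.unitaryGroup n ℂ)) [IsProbabilityMeasure μ] [μ.IsMulRightInvariant]

omit [IsProbabilityMeasure μ] in
/-- **THE MASS IS CONSTANT ON REGULAR ELEMENTS**: for `y` with `χ_{toMat y}` separable (so `toMat y = u D_θ u*`,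
`θ ∈ C`, file 3), `μ{g : Ad(g) y ∈ orbitMap(B_r × C)} = μ(E_r u⁻¹) = μ(E_r)` by right invariance.
[cite: Helgason2000, Ch. I §5 Thm. 5.17 p0186] -/
theorem measure_preimage_AdCoord_eq {r : ℝ} (y : Coord n) (hy : (toMat y).charpoly.Separable) :
    μ ((fun g : Matrix.unitaryGroup n ℂ => AdCoord (g : Matrix n n ℂ) y) ⁻¹'
      (orbitMap '' (Metric.ball (0 : OD n → ℂ) r ×ˢ chamber n))) = μ (coreSet n r) := by
  obtain ⟨u, hu, θ, hθ, hyu⟩ := exists_toMat_eq_conj_diagI_of_separable y hy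
  set u' : Matrix.unitaryGroup n ℂ := ⟨u, hu⟩ with hu'
  have hset : (fun g : Matrix.unitaryGroup n ℂ => AdCoord (g : Matrix n n ℂ) y) ⁻¹'
      (orbitMap '' (Metric.ball (0 : OD n → ℂ) r ×ˢ chamber n)) =
      (fun g : Matrix.unitaryGroup n ℂ => g * u') ⁻¹'
        ((fun h : Matrix.unitaryGroup n ℂ => AdCoord (h : Matrix n n ℂ) (((0 : OD n → ℂ), θ) : Coord n)) ⁻¹'
          (orbitMap '' (Metric.ball (0 : OD n → ℂ) r ×ˢ chamber n))) := by
    ext g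
    simp only [Set.mem_preimage]
    have : AdCoord ((g * u' : Matrix.unitaryGroup n ℂ) : Matrix n n ℂ) (((0 : OD n → ℂ), θ) : Coord n) =
        AdCoord (g : Matrix n n ℂ) y := by
      apply toMat_injective
      rw [toMat_AdCoord, toMat_AdCoord, toMat_zero_left, hyu, Submonoid.coe_mul, star_mul]
      change (g : Matrix n n ℂ) * u * diagI θ * (star u * star (g : Matrix n n ℂ)) = _
      noncomm_ring
    rw [this]
  rw [hset, measure_preimage_mul_right, preimage_AdCoord_slice_eq_coreSet hθ]

/-- **The non-regular elements are Lebesgue-null** in the flat coordinates (gen 14's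
`addHaar_setOf_not_separable_charpoly_eq_zero` transported through `toLie`). [cite: BrockerTomDieck1985, IV (2.11)(ii) p0157] -/
theorem volume_setOf_not_separable : volume {y : Coord n | ¬ (toMat y).charpoly.Separable} = 0 := by
  letI : MeasurableSpace (unitaryLogChart n).lie := borel _
  haveI : BorelSpace (unitaryLogChart n).lie := ⟨rfl⟩
  set e : Coord n ≃ᵐ (unitaryLogChart n).lie := (toLie (n := n)).toHomeomorph.toMeasurableEquiv with he
  haveI : (Measure.map e volume).IsAddHaarMeasure := (toLie (n := n)).isAddHaarMeasure_map volume
  have h0 := addHaar_setOf_not_separable_charpoly_eq_zero ((unitaryLogChart n).lie) (Measure.map e volume)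
    (exists_mem_unitaryLogChart_lie_separable (n := n))
  rw [MeasurableEquiv.map_apply] at h0
  exact h0

/-- Almost every `y` is regular. [cite: BrockerTomDieck1985, IV (2.11)(ii) p0157] -/
theorem ae_separable : ∀ᵐ y : Coord n, (toMat y).charpoly.Separable := by
  rw [ae_iff]
  exact volume_setOf_not_separable

/-- `(g, y) ↦ Ad(g) y` is jointly measurable on `U(n) × Coord`. [cite: BrockerTomDieck1985, IV (1.8) p0152] -/
theorem measurable_AdCoord_uncurry :
    Measurable fun p : Matrix.unitaryGroup n ℂ × Coord n => AdCoord (p.1 : Matrix n n ℂ) p.2 :=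
  (continuous_AdCoord_uncurry.comp ((continuous_subtype_val.comp continuous_fst).prodMk continuous_snd)).measurable

/-- `g ↦ Ad(g) y` is measurable. [cite: BrockerTomDieck1985, IV (1.8) p0152] -/
theorem measurable_AdCoord_left (y : Coord n) :
    Measurable fun g : Matrix.unitaryGroup n ℂ => AdCoord (g : Matrix n n ℂ) y :=
  (continuous_AdCoord_uncurry.comp ((continuous_subtype_val).prodMk continuous_const)).measurable

/-- Moving the indicator by `Ad(g)`: `∫ Φ(y) 1_R(Ad(g) y) dy = ∫_R Φ` for `Ad`-invariant `Φ` (`Ad(g)` preserves `dy`).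
[cite: Helgason2000, Ch. I §5 Thm. 5.17 p0186] -/
theorem lintegral_mul_indicator_AdCoord (g : Matrix.unitaryGroup n ℂ) {Φ : Coord n → ℝ≥0∞} (hΦm : Measurable Φ)
    (hΦ : ∀ u ∈ Matrix.unitaryGroup n ℂ, ∀ x, Φ (AdCoord u x) = Φ x) {R : Set (Coord n)} (hR : MeasurableSet R) :
    ∫⁻ y, Φ y * R.indicator 1 (AdCoord (g : Matrix n n ℂ) y) = ∫⁻ y in R, Φ y := by
  have hmp := measurePreserving_AdCoord (n := n) g.2
  calc ∫⁻ y, Φ y * R.indicator 1 (AdCoord (g : Matrix n n ℂ) y)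
      = ∫⁻ y, (fun w => Φ w * R.indicator 1 w) (AdCoord (g : Matrix n n ℂ) y) := by
        refine lintegral_congr fun y => ?_
        simp only [hΦ _ g.2 y]
    _ = ∫⁻ w, Φ w * R.indicator 1 w := hmp.lintegral_comp (hΦm.mul (measurable_one.indicator hR))
    _ = ∫⁻ w, R.indicator Φ w := by
        refine lintegral_congr fun w => ?_
        by_cases hw : w ∈ R
        · simp [Set.indicator_of_mem hw]
        · simp [Set.indicator_of_notMem hw]
    _ = ∫⁻ y in R, Φ y := lintegral_indicator hR Φ

/-- **THE KEY IDENTITY `μ(E_r) · ∫ Φ = a_r · J_C(Φ)`** for measurable `Ad`-invariant `Φ ≥ 0`, obtained by averaging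
`∫ Φ · 1_R ∘ Ad(g) = a_r J_C(Φ)` over `g` (Tonelli) and evaluating the mass `μ{g : Ad(g)y ∈ R} = μ(E_r)` at almost
every `y`. [cite: Helgason2000, Ch. I §5 Thm. 5.17 p0186] -/
theorem measure_coreSet_mul_lintegral_eq {r : ℝ} (hinj : InjOn (orbitMap (n := n)) (Metric.ball 0 r ×ˢ chamber n))
    {Φ : Coord n → ℝ≥0∞} (hΦm : Measurable Φ) (hΦ : ∀ u ∈ Matrix.unitaryGroup n ℂ, ∀ x, Φ (AdCoord u x) = Φ x) :
    μ (coreSet n r) * ∫⁻ y, Φ y = sliceConst n r * chamberIntegral Φ := by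
  set R := orbitMap '' (Metric.ball (0 : OD n → ℂ) r ×ˢ chamber n) with hRdef
  have hR : MeasurableSet R := measurableSet_image_orbitMap hinj
  set F : Matrix.unitaryGroup n ℂ → Coord n → ℝ≥0∞ := fun g y => Φ y * R.indicator 1 (AdCoord (g : Matrix n n ℂ) y)
    with hF
  have hFm : Measurable (Function.uncurry F) :=
    (hΦm.comp measurable_snd).mul ((measurable_one.indicator hR).comp measurable_AdCoord_uncurry)
  -- the `g`-integral first: each slice equals `∫_R Φ = a_r J_C(Φ)`
  have hB : ∫⁻ g, ∫⁻ y, F g y ∂volume ∂μ = sliceConst n r * chamberIntegral Φ := by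
    have : ∀ g, ∫⁻ y, F g y ∂volume = ∫⁻ y in R, Φ y := fun g => lintegral_mul_indicator_AdCoord g hΦm hΦ hR
    rw [lintegral_congr this, lintegral_const, measure_univ, mul_one, hRdef, lintegral_image_orbitMap hinj hΦm hΦ]
  -- the `y`-integral first: the inner integral is `Φ(y) · m(y)`, `m(y) = μ(E_r)` a.e.
  have hinner : ∀ y, ∫⁻ g, F g y ∂μ =
      Φ y * μ ((fun g : Matrix.unitaryGroup n ℂ => AdCoord (g : Matrix n n ℂ) y) ⁻¹' R) := by
    intro y
    have hmg : Measurable fun g : Matrix.unitaryGroup n ℂ =>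
        R.indicator (1 : Coord n → ℝ≥0∞) (AdCoord (g : Matrix n n ℂ) y) :=
      (measurable_one.indicator hR).comp (measurable_AdCoord_left y)
    rw [hF]
    simp only
    rw [lintegral_const_mul _ hmg]
    congr 1
    have : (fun g : Matrix.unitaryGroup n ℂ => R.indicator (1 : Coord n → ℝ≥0∞) (AdCoord (g : Matrix n n ℂ) y)) =
        ((fun g : Matrix.unitaryGroup n ℂ => AdCoord (g : Matrix n n ℂ) y) ⁻¹' R).indicator 1 := by
      funext g
      rfl
    rw [this, lintegral_indicator_one ((measurable_AdCoord_left y) hR)]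
  have hae : (fun y => Φ y * μ ((fun g : Matrix.unitaryGroup n ℂ => AdCoord (g : Matrix n n ℂ) y) ⁻¹' R)) =ᵐ[volume]
      fun y => Φ y * μ (coreSet n r) := by
    filter_upwards [ae_separable (n := n)] with y hy
    rw [hRdef, measure_preimage_AdCoord_eq μ y hy]
  calc μ (coreSet n r) * ∫⁻ y, Φ y = ∫⁻ y, Φ y * μ (coreSet n r) := by rw [lintegral_mul_const _ hΦm, mul_comm]
    _ = ∫⁻ y, Φ y * μ ((fun g : Matrix.unitaryGroup n ℂ => AdCoord (g : Matrix n n ℂ) y) ⁻¹' R) :=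
        (lintegral_congr_ae hae).symm
    _ = ∫⁻ y, ∫⁻ g, F g y ∂μ := lintegral_congr fun y => (hinner y).symm
    _ = ∫⁻ g, ∫⁻ y, F g y ∂volume ∂μ := (lintegral_lintegral_swap hFm.aemeasurable).symm
    _ = sliceConst n r * chamberIntegral Φ := hB

end Averaging

/-! ## §4 The Lie-algebra class-function formula -/

/-- **HELGASON'S THEOREM I.5.17 FOR `𝔲(n)`, `Ad`-INVARIANT INTEGRANDS** (flat coordinates, chamber form): there is a
constant `c ∈ (0, ∞)` such that `∫ Φ d(vol) = c · ∫_C Φ(0, θ) Π_{j≺k}(θ_j − θ_k)² dθ` for every measurable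
`Ad(U(n))`-invariant `Φ : Coord n → [0, ∞]`.  (`μ`: any right-invariant probability measure on `U(n)`, used only in
the proof.) [cite: Helgason2000, Ch. I §5 Thm. 5.17 p0186] -/
theorem exists_const_lintegral_eq_chamberIntegral (μ : Measure (Matrix.unitaryGroup n ℂ)) [IsProbabilityMeasure μ]
    [μ.IsMulRightInvariant] :
    ∃ c : ℝ≥0∞, c ≠ 0 ∧ c ≠ ⊤ ∧ ∀ Φ : Coord n → ℝ≥0∞, Measurable Φ →
      (∀ u ∈ Matrix.unitaryGroup n ℂ, ∀ x, Φ (AdCoord u x) = Φ x) → ∫⁻ y, Φ y = c * chamberIntegral Φ := by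
  obtain ⟨r, hr, hinj⟩ := exists_injOn_orbitMap (n := n)
  have h1 := measure_coreSet_mul_lintegral_eq μ hinj (Φ := fun _ => 1) measurable_const (fun _ _ _ => rfl)
  have hm0 : μ (coreSet n r) ≠ 0 := by
    intro h0
    rw [h0, zero_mul] at h1
    exact mul_ne_zero (sliceConst_ne_zero hr) chamberIntegral_one_ne_zero h1.symm
  have hmt : μ (coreSet n r) ≠ ⊤ := measure_ne_top μ _
  refine ⟨sliceConst n r / μ (coreSet n r), (ENNReal.div_pos_iff.2 ⟨sliceConst_ne_zero hr, hmt⟩).ne',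
    ENNReal.div_ne_top (sliceConst_ne_top r) hm0, fun Φ hΦm hΦ => ?_⟩
  have h := measure_coreSet_mul_lintegral_eq μ hinj hΦm hΦ
  rw [ENNReal.mul_div_right_comm.symm, ENNReal.eq_div_iff hm0 hmt]
  exact h

/-- **HELGASON'S THEOREM I.5.17 FOR `𝔲(n)`, `Ad`-INVARIANT INTEGRANDS, `ℝⁿ` FORM**: `∫ Φ d(vol) =
c' · ∫_{ℝⁿ} Φ(0, θ) Π_{j≺k}(θ_j − θ_k)² dθ` with `c' = c/n! ∈ (0, ∞)` (file 3: `∫_{ℝⁿ} = n! ∫_C` for the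
`S(n)`-invariant integrand). [cite: Helgason2000, Ch. I §5 Thm. 5.17 p0186] [cite: BrockerTomDieck1985, IV (1.11) p0153] -/
theorem exists_const_lintegral_eq_lintegral_slice (μ : Measure (Matrix.unitaryGroup n ℂ)) [IsProbabilityMeasure μ]
    [μ.IsMulRightInvariant] :
    ∃ c : ℝ≥0∞, c ≠ 0 ∧ c ≠ ⊤ ∧ ∀ Φ : Coord n → ℝ≥0∞, Measurable Φ →
      (∀ u ∈ Matrix.unitaryGroup n ℂ, ∀ x, Φ (AdCoord u x) = Φ x) →
      ∫⁻ y, Φ y = c * ∫⁻ θ : n → ℝ, Φ ((0 : OD n → ℂ), θ) * ENNReal.ofReal (∏ p : OD n, (θ p.1.1 - θ p.1.2) ^ 2) := by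
  obtain ⟨c, hc0, hct, hc⟩ := exists_const_lintegral_eq_chamberIntegral (n := n) μ
  have hN0 : ((Fintype.card n).factorial : ℝ≥0∞) ≠ 0 := Nat.cast_ne_zero.2 (Nat.factorial_ne_zero _)
  have hNt : ((Fintype.card n).factorial : ℝ≥0∞) ≠ ⊤ := ENNReal.natCast_ne_top _
  refine ⟨c / (Fintype.card n).factorial, (ENNReal.div_pos_iff.2 ⟨hc0, hNt⟩).ne', ENNReal.div_ne_top hct hN0,
    fun Φ hΦm hΦ => ?_⟩
  have hsymm : ∀ (σ : Perm n) (θ : n → ℝ),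
      Φ ((0 : OD n → ℂ), θ ∘ σ) * ENNReal.ofReal (∏ p : OD n, ((θ ∘ σ) p.1.1 - (θ ∘ σ) p.1.2) ^ 2) =
        Φ ((0 : OD n → ℂ), θ) * ENNReal.ofReal (∏ p : OD n, (θ p.1.1 - θ p.1.2) ^ 2) := fun σ θ => by
    rw [slice_comp_perm_invariant hΦ σ θ, prod_OD_sub_sq_comp_perm θ σ]
  rw [hc Φ hΦm hΦ, chamberIntegral,
    lintegral_eq_card_factorial_mul_lintegral_chamber
      (F := fun θ => Φ ((0 : OD n → ℂ), θ) * ENNReal.ofReal (∏ p : OD n, (θ p.1.1 - θ p.1.2) ^ 2)) hsymm,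
    ← mul_assoc, ENNReal.div_mul_cancel hN0 hNt]

end Literature.RepresentationTheory.CompactGroups.WeylIntegration
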